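import Literature.MathematicalPhysics.QuantumFieldTheory.Balaban1983to89.B9Thm39CinvSumsYLoc
import Literature.MathematicalPhysics.QuantumFieldTheory.Balaban1983to89.B9Thm39CinvTorusRegularFinal
import Literature.MathematicalPhysics.QuantumFieldTheory.Balaban1983to89.B9Thm39CinvUpperLMember

/-!
# `Balaban1983to89.B9Thm39CinvFinalLoc` — [Balaban1985BackgroundPropagators] THEOREM 3.9 pp. 411–413 ⇒ THEOREM 3.2 (3.48) p. 398 FOR
# `C(U) = (Q′G′²Q′*)⁻¹(U)` AT def-Y's CARRIERS, RE-ASSEMBLED WITH THE PRINTED LOCALIZATIONS — FILE 6 §1/§3 and FILE 8 of the module on FILE 9a: the cube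
# letters' (3.48) blocks un-localized, the [2]-difference of (3.97) localized to `□̃`-rows × `S_□`-columns (cell `lit-balaban`, G-B9-LETTERS module M5.6
# FILE 9b, seat p21 gen 33 — the displayed-input repair of M5.6's end-to-end statement)

statement-level skeleton of published theorems with citation tags; proofs where landed; nothing here is a claim about the Yang–Mills mass gap

CITATION HEADER (lean-in-tree rule).  B9 = T. Bałaban, *Propagators for lattice gauge theories in a background field*, Commun. Math. Phys. **99** (1985)
389–434 (journal page = PDF page + 388; held `paper:balaban1985-cmp99-background-propagators`).  p. 409 (3.87) «C₀ = Σ_{□∈𝒟} h_□C_□h_□», «The operators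
constructed for this sequence, which we denote by G′_□(U), C_□(U) = (Q′(U)G′²_□(U)Q′*(U))⁻¹, G_□(U), satisfy all the inequalities of Theorems 3.1–3.3»;
p. 411 (3.95) «Q′G′²Q′*C₀ = I + Σ_□(1 − □̃)Q′G′²Q′*h_□C_□h_□ + Σ_□ □̃Q′(G′² − G′²_□)Q′*h_□C_□h_□ + Σ_□[□̃Q′G′²_□Q′*, h_□]C_□h_□ = I − R», (3.96)
«(Q′G′²Q′*)⁻¹ = C₀(I − R)⁻¹ = Σ C₀Rⁿ.  The series is convergent in the weighted supremum norm on 𝔅 appearing in the inequality (3.48)»; p. 412 (3.97) «the usual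
factors multiplied by e^{−2δ₀M}»; p. 413 Theorem 3.9 «For M sufficiently large … This theorem implies Theorem 3.2»; p. 398 Theorem 3.2 (3.48)
«|(Q′(U)G′²(U)Q′*(U))⁻¹(y, y′)| ≦ B₀(Lʲη)⁻⁴(L^{j′}η)^{−d}e^{−δ₀d(y,y′)}, y, y′ ∈ 𝔅»; p. 397 Theorem 3.1 (3.42).  [4] = [Balaban1984PropagatorsII] Lemma 2.1 p. 234,
(2.51)–(2.54) pp. 232–233, (2.66) p. 234, (2.83)–(2.87) pp. 237–238.  Rows B9.Thm3.9 × B9.Thm3.2 × B9.Thm3.1 × B9.Eq3.95 × B9.Eq3.96 × B9.Eq3.97 × B9.Eq3.87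
(cells only; no row head changes).

WHY THIS FILE.  FILE 9a (`B9Thm39CinvSumsYLoc`) explains the two over-strong displayed inputs of FILES 6/8 (the (3.48) blocks `hC` of the `C_□` localized to
`S_□`; the [2]-difference `hD` globally small) and re-proves the three sums and the glue with the PRINTED shapes: `hC : conj b (s•C_□) ≺ B₀P(a)e^{−bδ₀d}` for all
rows/columns, and `hD` a majorant of the LOCALIZED difference `conj b (s′•(M_{1_{S^χ_□}}·(L − L_□)·M_{1_{S_□}}))` («□̃Q′(G′² − G′²_□)Q′*h_□»: rows in `□̃`, columns in
`S_□ ⊇ supp h_□`), plus the printed fact `supp χ_□ ⊂ S^χ_□` (`χ_□ = □̃` is a characteristic function).  THIS FILE is FILE 6 §1/§3 and FILE 8 VERBATIM on top of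
FILE 9a: same conclusions, same constants; only the three displayed binders `hC`, `hD`, `hχsupp` differ.  FILE 10 instantiates it at the cube cover of record.

WHAT IS PROVED (all `theorem`s, 0 `def`, 0 sorry, 0 new named facts).
* §1 ★★ `hasMajorant_conj_Cinv_final_loc` — FILE 6 §1 with the repaired binders: block letters `L`, `T` (`T·L = 1`), local letters `L_□`, `C_□`, the block
  cut-offs `h_□` (`Σh² = 1`, `|h| ≦ 1`, `supp h_□ ⊂ S_□`, overlap `≦ N`, slow variation `ℓ₀ + ℓ₁d`), characteristic cut-offs `χ_□` (`0 ≦ χ ≦ 1`, `= 1` over `S^χ_□`,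
  `= 0` off `S^χ_□`, `S^χ_□` separated from `S_□`'s complement side: `d(a,a″) ≧ D_sep` for `a ∉ S^χ_□`, `a″ ∈ S_□`), the local inverse property, un-localized
  per-cube (3.48) blocks `hC`, upper majorants `hL`/`hLloc`, the localized [2]-difference `hD`, scale transfer, (2.54), symmetry, [4] Lemma 2.1 at `(δ₀, b−ρ)` and
  `(ρδ₀, α′)`, exponent splits, located smallness ⟹ `conj b (s•T) ≺ N·B₀·c₁(ρδ₀,α′)(1 − (θ₁+θ₂+θ₃)c₁)⁻¹·P(a)·e^{−(1−α′)ρδ₀d(a,a′)}` with FILE 6's `θ₁, θ₂, θ₃`.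
* §2 AT def-Y's LETTERS: ★★ `hasMajorant_conj_XinvY_final_loc` — §1 with `L := XY i parS G′ U`, `T := XinvY i parS G′ U` (`IsUnit XY`), `L_□ := XY i parS G′_□ U`,
  the upper majorants from SITE majorants `hGG`/`hGGc` by FILE 3b (as FILE 6 §3).
* §3 ★★ `hasMajorant_conj_XinvY_of_eBlockInv_loc` — FILE 8 re-assembled: §2 fed with FILE 7's site majorants from `EBlock (kernelFamilySInv …)` of `G′` and of
  every `G′_□` (M5.5's output), at `P = ℓ⁻⁴`, `s′ = η²η²`, `κ_G = (M₂Σ‖b_j‖B_G)²C_Gc₁((1−α_G)δ_G, α₂)`;  ★★ `norm_XinvY_apply_of_eBlockInv_loc` — (3.48)'s printed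
  shape pointwise for one-block sources (FILE 1's block reading BY NAME).

HONEST SCOPE / NOT CLAIMED.  Exactly FILES 6/8's scope with three binders repaired: sup-entry (3.48) only; DISPLAYED remain the `EBlock`s (M5.5, above its own
displayed inputs), the cube letters `C_□` with their un-localized (3.48) blocks `hC` and local inverse property `hloc` (M5.2-E), the LOCALIZED [2]-difference
majorant `hD` (cell GAPS G-B9-05 — NOT derived in the tree), the cut-off data (discharged at the cube cover of record in FILE 10), the geometry and the located
smallness («M sufficiently large»).  Theorem 3.9's walk expansion (3.98)/locality clause not reproduced ((3.96)'s fixed-point form suffices).  Finite 𝕋 member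
of the k-level V1 family; constants explicit; nothing continuum, nothing about the mass gap; NOT summit progress.  RELATED, NOT DUPLICATED: FILES 1–8 (kept; USED
BY NAME: FILE 1 §5 reading, FILE 3b `hasMajorant_conj_XY_of_site`, FILE 6 `restrictScalars_XinvY_mul_XY`, FILE 7 `hasMajorant_conj_GG_of_eBlockInv`), r06's scalar
`B9Thm39Whole`, dag-n06-j/w1 `B9Thm32SiteCVariationalY` (variational road, cell pub-ymgap).  Searched 2026-08-28: `lean search 'CinvFinalLoc|XinvY_of_eBlockInv_loc' --decl` = ∅.
-/

noncomputable section

namespace Literature.MathematicalPhysics.QuantumFieldTheory.Balaban1983to89.B9Thm39CinvFinalLoc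

open Node00 B9CubeLettersInvReadings
open B6Ineq2142KLevelV1 (β)
open B6KLevelCensusIndexV1 (KIdx)
open B6RandomWalk (HasMajorant Triangle254 Ineq261 Ineq263 hasMajorant_mono)
open B9Thm34Ext (toB6)
open B9FromB6 (EBlock)
open B9GeoNormsKLevelV1 (geo9K)
open B9Eq352DivFormLetters (conj)
open B9Thm37CubeCoverCommutators (cutMulY)
open B9Thm39CinvTorusRegular (norm_apply_le_of_hasMajorant_blk)
open B9Thm39CinvSumsYLoc (hR₁_of_cubes' hR₂_of_cubes_loc hR₃_of_cubes' hasMajorant_conj_Cinv_of_cubes')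
open B9Thm39CinvSandwichQ (hasMajorant_conj_XY_of_site)
open B9Thm39CinvTorusRegularFinal (restrictScalars_XinvY_mul_XY)
open B9Thm39CinvUpperLMember (hasMajorant_conj_GG_of_eBlockInv)

variable {d ℓ : ℕ} {hd : 1 ≤ d + 1} {hL : Odd (ℓ + 1) ∧ 1 < ℓ + 1} {b₀ b₁ : ℝ}
variable {𝔸 : Type} [NormedRing 𝔸] [NormedAlgebra ℂ 𝔸] [CompleteSpace 𝔸]
variable {ι : Type} [Fintype ι] [DecidableEq ι]
variable (i : KIdx d ℓ hd hL b₀ b₁) (b : Module.Basis ι ℝ 𝔸)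
variable [Fintype (geo9K i).Site] [DecidableEq (geo9K i).Site] {Rr : ℝ} {Hp : Prop}
variable (ιB : BlkY i → IBondY i)

/-! ## §1 ★★ Theorem 3.9 ⇒ the (3.48)-shape majorant of `conj b (s•C(U))`, every input per-cube and displayed IN ITS PRINTED SHAPE -/

omit [CompleteSpace 𝔸] in
/-- ★★ **THEOREM 3.9 ⇒ THEOREM 3.2's (3.48) BLOCK FOR `C(U) = (Q′G′²Q′*)⁻¹(U)` AT def-Y's CARRIERS, FROM PER-CUBE DISPLAYED DATA IN THE PRINTED SHAPES** (FILE 6 §1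
with `hC` un-localized, `hD` localized to `S^χ_□`-rows × `S_□`-columns, and `supp χ_□ ⊂ S^χ_□`): `conj b (s•T) ≺ N B₀ c₁(ρδ₀,α′)(1 − (θ₁+θ₂+θ₃)c₁(ρδ₀,α′))⁻¹·P(a)·e^{−(1−α′)ρδ₀d(a,a′)}`
with `θ₁ = NκB₀Cc₁(δ₀,b−ρ)e^{−a_sepδ₀D_sep}`, `θ₂ = Nκ_De^{−2δ₀D_sep}B₀Cc₁(δ₀,b−ρ)`, `θ₃ = N(ℓ₀ + ℓ₁(α_cδ₀)⁻¹)κB₀Cc₁(δ₀,b−ρ)`.  FILE 9a §3 ∘ FILE 9a §2.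
[cite: Balaban1985BackgroundPropagators, Thm 3.9 p.413 + (3.95)–(3.97) pp.411–412 + (3.87) p.409 + Thm 3.2 (3.48) p.398; Balaban1984PropagatorsII, (2.66) p.234 + (2.83)–(2.85) pp.237–238] -/
theorem hasMajorant_conj_Cinv_final_loc (d' : ℕ)
    {δ₀ aL aD αc αst asep ρ bb κ κD Dsep ℓ₀ ℓ₁ B₀ C N s s' α' θ₁ θ₂ θ₃ : ℝ} (P : (geo9K i).Site → ℝ)
    {κι : Type} [Fintype κι] (Sχ S : κι → Finset (geo9K i).Site) (χ h : κι → BlkY i → ℝ)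
    {L T : Module.End ℝ (BlkY i → 𝔸)} (Lloc Cl : κι → Module.End ℝ (BlkY i → 𝔸))
    -- constants and exponent bookkeeping
    (hs : s' * s = 1) (hκ : 0 ≤ κ) (hκD : 0 ≤ κD) (hℓ₀ : 0 ≤ ℓ₀) (hℓ₁ : 0 ≤ ℓ₁) (hB₀ : 0 ≤ B₀) (hC0 : 0 ≤ C) (hN : 0 ≤ N)
    (hP : ∀ a, 0 < P a) (hδ₀ : 0 ≤ δ₀) (hasep : 0 ≤ asep) (hρ : 0 ≤ ρ) (hρb : ρ ≤ bb) (hαc : 0 < αc * δ₀) (hα'1 : α' ≤ 1)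
    (hsplit₁ : αst + asep + ρ ≤ aL) (hsplit₂ : αst + ρ ≤ aD) (hsplit₃ : αst + αc + ρ ≤ aL)
    (hθ₁ : θ₁ = N * (κ * B₀ * C * B6.c1 d' δ₀ (bb - ρ) * Real.exp (-(asep * δ₀ * Dsep))))
    (hθ₂ : θ₂ = N * (κD * Real.exp (-(2 * δ₀ * Dsep)) * B₀ * C * B6.c1 d' δ₀ (bb - ρ)))
    (hθ₃ : θ₃ = N * ((ℓ₀ + ℓ₁ * (αc * δ₀)⁻¹) * κ * B₀ * C * B6.c1 d' δ₀ (bb - ρ)))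
    -- the geometry of the member
    (htri : Triangle254 (toB6 (geo9K i) Rr Hp)) (hrefl : ∀ y : (geo9K i).Site, (geo9K i).dist y y = 0)
    (hsymm : ∀ a a' : (geo9K i).Site, (geo9K i).dist a a' = (geo9K i).dist a' a) (hdnn : ∀ a a' : (geo9K i).Site, 0 ≤ (geo9K i).dist a a')
    (hST : B9Ineq347.ScaleTransfer (geo9K i) δ₀ αst C P) (h261b : Ineq261 d' (toB6 (geo9K i) Rr Hp) δ₀ (bb - ρ))
    (h261 : Ineq261 d' (toB6 (geo9K i) Rr Hp) (ρ * δ₀) α') (h263 : Ineq263 d' (toB6 (geo9K i) Rr Hp) (ρ * δ₀) α')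
    (hsmall : (θ₁ + θ₂ + θ₃) * B6.c1 d' (ρ * δ₀) α' < 1)
    -- the letters: inverse, partition, cut-offs, separation, slow variation, local inverse property
    (hinv : T * L = 1) (hsq : ∀ t, ∑ k, h k t ^ 2 = 1) (hh : ∀ k t, |h k t| ≤ 1) (hS : ∀ k t, h k t ≠ 0 → ιB t ∈ S k)
    (hcnt : ∀ a : (geo9K i).Site, (∑ k, if a ∈ S k then (1 : ℝ) else 0) ≤ N)
    (hχ01 : ∀ k t, 0 ≤ χ k t ∧ χ k t ≤ 1) (hχS : ∀ k t, ιB t ∈ Sχ k → χ k t = 1) (hχsupp : ∀ k t, χ k t ≠ 0 → ιB t ∈ Sχ k)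
    (hsep : ∀ k a, a ∉ Sχ k → ∀ a'' ∈ S k, Dsep ≤ (geo9K i).dist a a'')
    (hLip : ∀ k (t t' : BlkY i), |h k t' - h k t| ≤ ℓ₀ + ℓ₁ * (geo9K i).dist (ιB t) (ιB t'))
    (hloc : ∀ k, (cutMulY (𝔸 := 𝔸) (h k)).restrictScalars ℝ * ((cutMulY (𝔸 := 𝔸) (χ k)).restrictScalars ℝ * Lloc k) * Cl k *
      (cutMulY (𝔸 := 𝔸) (h k)).restrictScalars ℝ = (cutMulY (𝔸 := 𝔸) (h k)).restrictScalars ℝ * (cutMulY (𝔸 := 𝔸) (h k)).restrictScalars ℝ)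
    -- the per-cube analytic blocks (printed shapes)
    (hC : ∀ k, HasMajorant (g := toB6 (geo9K i) Rr Hp) (fun p : BlkY i × ι => ιB p.1) (conj b (s • Cl k))
      (fun a a' => B₀ * P a * Real.exp (-(bb * δ₀ * (geo9K i).dist a a'))))
    (hLmaj : HasMajorant (g := toB6 (geo9K i) Rr Hp) (fun p : BlkY i × ι => ιB p.1) (conj b (s' • L))
      (fun a a'' => κ * (P a)⁻¹ * Real.exp (-(aL * δ₀ * (geo9K i).dist a a''))))
    (hLloc : ∀ k, HasMajorant (g := toB6 (geo9K i) Rr Hp) (fun p : BlkY i × ι => ιB p.1) (conj b (s' • Lloc k))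
      (fun a a'' => κ * (P a)⁻¹ * Real.exp (-(aL * δ₀ * (geo9K i).dist a a''))))
    (hD : ∀ k, HasMajorant (g := toB6 (geo9K i) Rr Hp) (fun p : BlkY i × ι => ιB p.1)
      (conj b (s' • ((cutMulY (𝔸 := 𝔸) (fun t : BlkY i => if ιB t ∈ Sχ k then (1 : ℝ) else 0)).restrictScalars ℝ * (L - Lloc k) *
        (cutMulY (𝔸 := 𝔸) (fun t : BlkY i => if ιB t ∈ S k then (1 : ℝ) else 0)).restrictScalars ℝ)))
      (fun a a'' => κD * Real.exp (-(2 * δ₀ * Dsep)) * (P a)⁻¹ * Real.exp (-(aD * δ₀ * (geo9K i).dist a a'')))) :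
    HasMajorant (g := toB6 (geo9K i) Rr Hp) (fun p : BlkY i × ι => ιB p.1) (conj b (s • T))
      (fun a a' => N * B₀ * B6.c1 d' (ρ * δ₀) α' * (1 - (θ₁ + θ₂ + θ₃) * B6.c1 d' (ρ * δ₀) α')⁻¹ * P a *
        Real.exp (-((1 - α') * (ρ * δ₀) * (geo9K i).dist a a'))) := by
  have hc1 : 0 ≤ B6.c1 d' δ₀ (bb - ρ) := B6RandomWalk.c1_nonneg d' δ₀ _
  have hθ₁0 : 0 ≤ θ₁ := by
    rw [hθ₁]; exact mul_nonneg hN (mul_nonneg (mul_nonneg (mul_nonneg (mul_nonneg hκ hB₀) hC0) hc1) (Real.exp_nonneg _))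
  have hθ₂0 : 0 ≤ θ₂ := by
    rw [hθ₂]; exact mul_nonneg hN (mul_nonneg (mul_nonneg (mul_nonneg (mul_nonneg hκD (Real.exp_nonneg _)) hB₀) hC0) hc1)
  have hθ₃0 : 0 ≤ θ₃ := by
    rw [hθ₃]
    exact mul_nonneg hN (mul_nonneg (mul_nonneg (mul_nonneg (mul_nonneg
      (add_nonneg hℓ₀ (mul_nonneg hℓ₁ (inv_nonneg.mpr hαc.le))) hκ) hB₀) hC0) hc1)
  have hαr : 0 ≤ (1 - α') * (ρ * δ₀) := mul_nonneg (sub_nonneg.mpr hα'1) (mul_nonneg hρ hδ₀)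
  have hχ1 : ∀ k t, |χ k t| ≤ 1 := fun k t => by
    obtain ⟨h0, h1⟩ := hχ01 k t
    rw [abs_le]; constructor <;> linarith
  -- the per-cube (3.48) blocks at the weaker rate `ρδ₀` (e^{−bδ₀d} ≤ e^{−ρδ₀d})
  have hC' : ∀ k, HasMajorant (g := toB6 (geo9K i) Rr Hp) (fun p : BlkY i × ι => ιB p.1) (conj b (s • Cl k))
      (fun a a' => B₀ * P a * Real.exp (-(ρ * δ₀ * (geo9K i).dist a a'))) := fun k =>
    hasMajorant_mono (g := toB6 (geo9K i) Rr Hp) _ (hC k) fun a a' => by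
      refine mul_le_mul_of_nonneg_left (Real.exp_le_exp.mpr ?_) (mul_nonneg hB₀ (hP a).le)
      have h1 := mul_le_mul_of_nonneg_right hρb (mul_nonneg hδ₀ (hdnn a a'))
      nlinarith [h1]
  -- the three sums (FILE 9a)
  have h1 := hR₁_of_cubes' i b ιB (Rr := Rr) (Hp := Hp) d' P Sχ S χ h Cl hs hκ hB₀ hC0 hP hδ₀ hasep hρ hsplit₁ htri hsymm hdnn hST h261b hχ01 hχS
    hh hS hsep hcnt hLmaj hC
  have h2 := hR₂_of_cubes_loc i b ιB (Rr := Rr) (Hp := Hp) d' P Sχ S χ h Lloc Cl hs hκD hB₀ hC0 hP hδ₀ hρ hsplit₂ htri hsymm hdnn hST h261b hχ1 hχsupp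
    hh hS hcnt hD hC
  have h3 := hR₃_of_cubes' i b ιB (Rr := Rr) (Hp := Hp) d' P S χ h Lloc Cl hs hκ hℓ₀ hℓ₁ hB₀ hC0 hP hδ₀ hαc hρ hsplit₃ htri hsymm hdnn hST h261b hχ1
    hh hS hLip hcnt hLloc hC
  rw [← hθ₁] at h1
  rw [← hθ₂] at h2
  rw [← hθ₃] at h3
  -- FILE 9a's glue at the rate `r := ρδ₀`
  exact hasMajorant_conj_Cinv_of_cubes' i b ιB d' P s S h (fun k => (cutMulY (𝔸 := 𝔸) (χ k)).restrictScalars ℝ) Cl Lloc hB₀ (fun a => (hP a).le) hN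
    hθ₁0 hθ₂0 hθ₃0 hαr htri hrefl hdnn h261 h263 hsmall hinv hsq hh hS hcnt hloc hC' h1 h2 h3

/-! ## §2 At def-Y's letters: `T := XinvY`, `L := XY`, `L_□ := XY` of the cube letter; the upper majorants from SITE majorants by FILE 3b -/

section Member

variable (parS : SiteParY 𝔸 i) (Gp : SiteOpY 𝔸 i) (U : CfgY 𝔸 i)

/-- ★★ **THEOREM 3.9 ⇒ (3.48)-SHAPE MAJORANT OF `conj b (s•(Q′G′²Q′*)⁻¹(U))` AT def-Y's LETTERS, PRINTED-SHAPE INPUTS** — §1 with `L := XY i parS G′ U`,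
`T := XinvY i parS G′ U` (`IsUnit XY`), `L_□ := XY i parS G′_□ U` for a family of cube site-letters `G′_□ = Oc □`, the upper majorants DISCHARGED by FILE 3b from
SITE majorants `hGG`/`hGGc` of `conj b (s′•(G′·G′))`, `conj b (s′•(G′_□·G′_□))` (contractive transporters, coordinate bound `M₂`; `κ = (M₂Σ_j‖b_j‖)²κ_G`); displayed:
the un-localized per-cube (3.48) blocks `hC` of the `C_□ = Cl □`, the local inverse property, the LOCALIZED [2]-difference `hD` of
`conj b (s′•(M_{1_{S^χ_□}}(XY G′ − XY G′_□)M_{1_{S_□}}))`, the cut-off data, the geometry, the smallness (FILE 6 §3 re-assembled).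
[cite: Balaban1985BackgroundPropagators, Thm 3.9 p.413 + (3.95)–(3.97) pp.411–412 + (3.21)/(3.25) pp.394–395 + Thm 3.2 (3.48) p.398] -/
theorem hasMajorant_conj_XinvY_final_loc (hunit : IsUnit (XY i parS Gp U))
    (hpar : ∀ z w : SiteY i, ‖(parS U z w : 𝔸)‖ ≤ 1 ∧ ‖(((parS U z w)⁻¹ : 𝔸ˣ) : 𝔸)‖ ≤ 1)
    {M₂ : ℝ} (hM₂ : 0 ≤ M₂) (hrepr : ∀ (v : 𝔸) (j : ι), |b.repr v j| ≤ M₂ * ‖v‖) (d' : ℕ)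
    {δ₀ aL aD αc αst asep ρ bb κG κD Dsep ℓ₀ ℓ₁ B₀ C N s s' α' θ₁ θ₂ θ₃ : ℝ} (P : (geo9K i).Site → ℝ)
    {κι : Type} [Fintype κι] (Sχ S : κι → Finset (geo9K i).Site) (χ h : κι → BlkY i → ℝ)
    (Oc : κι → SiteOpY 𝔸 i) (Cl : κι → Module.End ℝ (BlkY i → 𝔸))
    (hs : s' * s = 1) (hκG : 0 ≤ κG) (hκD : 0 ≤ κD) (hℓ₀ : 0 ≤ ℓ₀) (hℓ₁ : 0 ≤ ℓ₁) (hB₀ : 0 ≤ B₀) (hC0 : 0 ≤ C) (hN : 0 ≤ N)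
    (hP : ∀ a, 0 < P a) (hδ₀ : 0 ≤ δ₀) (hasep : 0 ≤ asep) (hρ : 0 ≤ ρ) (hρb : ρ ≤ bb) (hαc : 0 < αc * δ₀) (hα'1 : α' ≤ 1)
    (hsplit₁ : αst + asep + ρ ≤ aL) (hsplit₂ : αst + ρ ≤ aD) (hsplit₃ : αst + αc + ρ ≤ aL)
    (hθ₁ : θ₁ = N * (((M₂ * ∑ j, ‖b j‖) ^ 2 * κG) * B₀ * C * B6.c1 d' δ₀ (bb - ρ) * Real.exp (-(asep * δ₀ * Dsep))))
    (hθ₂ : θ₂ = N * (κD * Real.exp (-(2 * δ₀ * Dsep)) * B₀ * C * B6.c1 d' δ₀ (bb - ρ)))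
    (hθ₃ : θ₃ = N * ((ℓ₀ + ℓ₁ * (αc * δ₀)⁻¹) * ((M₂ * ∑ j, ‖b j‖) ^ 2 * κG) * B₀ * C * B6.c1 d' δ₀ (bb - ρ)))
    (htri : Triangle254 (toB6 (geo9K i) Rr Hp)) (hrefl : ∀ y : (geo9K i).Site, (geo9K i).dist y y = 0)
    (hsymm : ∀ a a' : (geo9K i).Site, (geo9K i).dist a a' = (geo9K i).dist a' a) (hdnn : ∀ a a' : (geo9K i).Site, 0 ≤ (geo9K i).dist a a')
    (hST : B9Ineq347.ScaleTransfer (geo9K i) δ₀ αst C P) (h261b : Ineq261 d' (toB6 (geo9K i) Rr Hp) δ₀ (bb - ρ))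
    (h261 : Ineq261 d' (toB6 (geo9K i) Rr Hp) (ρ * δ₀) α') (h263 : Ineq263 d' (toB6 (geo9K i) Rr Hp) (ρ * δ₀) α')
    (hsmall : (θ₁ + θ₂ + θ₃) * B6.c1 d' (ρ * δ₀) α' < 1)
    (hsq : ∀ t, ∑ k, h k t ^ 2 = 1) (hh : ∀ k t, |h k t| ≤ 1) (hS : ∀ k t, h k t ≠ 0 → ιB t ∈ S k)
    (hcnt : ∀ a : (geo9K i).Site, (∑ k, if a ∈ S k then (1 : ℝ) else 0) ≤ N)
    (hχ01 : ∀ k t, 0 ≤ χ k t ∧ χ k t ≤ 1) (hχS : ∀ k t, ιB t ∈ Sχ k → χ k t = 1) (hχsupp : ∀ k t, χ k t ≠ 0 → ιB t ∈ Sχ k)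
    (hsep : ∀ k a, a ∉ Sχ k → ∀ a'' ∈ S k, Dsep ≤ (geo9K i).dist a a'')
    (hLip : ∀ k (t t' : BlkY i), |h k t' - h k t| ≤ ℓ₀ + ℓ₁ * (geo9K i).dist (ιB t) (ιB t'))
    (hloc : ∀ k, (cutMulY (𝔸 := 𝔸) (h k)).restrictScalars ℝ *
      ((cutMulY (𝔸 := 𝔸) (χ k)).restrictScalars ℝ * (XY i parS (Oc k) U).restrictScalars ℝ) * Cl k * (cutMulY (𝔸 := 𝔸) (h k)).restrictScalars ℝ =
      (cutMulY (𝔸 := 𝔸) (h k)).restrictScalars ℝ * (cutMulY (𝔸 := 𝔸) (h k)).restrictScalars ℝ)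
    (hC : ∀ k, HasMajorant (g := toB6 (geo9K i) Rr Hp) (fun p : BlkY i × ι => ιB p.1) (conj b (s • Cl k))
      (fun a a' => B₀ * P a * Real.exp (-(bb * δ₀ * (geo9K i).dist a a'))))
    (hGG : HasMajorant (g := toB6 (geo9K i) Rr Hp) (fun p : SiteY i × ι => ιB (B6Geom246MultiLevelBox.blkOf i.D.toDomains p.1))
      (conj b (s' • ((Gp U).restrictScalars ℝ * (Gp U).restrictScalars ℝ)))
      (fun a a'' => κG * (P a)⁻¹ * Real.exp (-(aL * δ₀ * (geo9K i).dist a a''))))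
    (hGGc : ∀ k, HasMajorant (g := toB6 (geo9K i) Rr Hp) (fun p : SiteY i × ι => ιB (B6Geom246MultiLevelBox.blkOf i.D.toDomains p.1))
      (conj b (s' • ((Oc k U).restrictScalars ℝ * (Oc k U).restrictScalars ℝ)))
      (fun a a'' => κG * (P a)⁻¹ * Real.exp (-(aL * δ₀ * (geo9K i).dist a a''))))
    (hD : ∀ k, HasMajorant (g := toB6 (geo9K i) Rr Hp) (fun p : BlkY i × ι => ιB p.1)
      (conj b (s' • ((cutMulY (𝔸 := 𝔸) (fun t : BlkY i => if ιB t ∈ Sχ k then (1 : ℝ) else 0)).restrictScalars ℝ *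
        ((XY i parS Gp U).restrictScalars ℝ - (XY i parS (Oc k) U).restrictScalars ℝ) *
        (cutMulY (𝔸 := 𝔸) (fun t : BlkY i => if ιB t ∈ S k then (1 : ℝ) else 0)).restrictScalars ℝ)))
      (fun a a'' => κD * Real.exp (-(2 * δ₀ * Dsep)) * (P a)⁻¹ * Real.exp (-(aD * δ₀ * (geo9K i).dist a a'')))) :
    HasMajorant (g := toB6 (geo9K i) Rr Hp) (fun p : BlkY i × ι => ιB p.1) (conj b (s • (XinvY i parS Gp U).restrictScalars ℝ))
      (fun a a' => N * B₀ * B6.c1 d' (ρ * δ₀) α' * (1 - (θ₁ + θ₂ + θ₃) * B6.c1 d' (ρ * δ₀) α')⁻¹ * P a *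
        Real.exp (-((1 - α') * (ρ * δ₀) * (geo9K i).dist a a'))) := by
  have hK : ∀ a a'' : (geo9K i).Site, 0 ≤ κG * (P a)⁻¹ * Real.exp (-(aL * δ₀ * (geo9K i).dist a a'')) := fun a a'' =>
    mul_nonneg (mul_nonneg hκG (inv_nonneg.mpr (hP a).le)) (Real.exp_nonneg _)
  -- the upper majorants of `L = XY G′` and `L_□ = XY G′_□` from the site majorants (FILE 3b)
  have hLmaj : HasMajorant (g := toB6 (geo9K i) Rr Hp) (fun p : BlkY i × ι => ιB p.1) (conj b (s' • (XY i parS Gp U).restrictScalars ℝ))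
      (fun a a'' => ((M₂ * ∑ j, ‖b j‖) ^ 2 * κG) * (P a)⁻¹ * Real.exp (-(aL * δ₀ * (geo9K i).dist a a''))) :=
    hasMajorant_mono (g := toB6 (geo9K i) Rr Hp) _ (hasMajorant_conj_XY_of_site i b ιB parS Gp U hpar hM₂ hrepr s' hK hGG)
      fun a a'' => le_of_eq (by ring)
  have hLloc : ∀ k, HasMajorant (g := toB6 (geo9K i) Rr Hp) (fun p : BlkY i × ι => ιB p.1)
      (conj b (s' • (XY i parS (Oc k) U).restrictScalars ℝ))
      (fun a a'' => ((M₂ * ∑ j, ‖b j‖) ^ 2 * κG) * (P a)⁻¹ * Real.exp (-(aL * δ₀ * (geo9K i).dist a a''))) := fun k =>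
    hasMajorant_mono (g := toB6 (geo9K i) Rr Hp) _ (hasMajorant_conj_XY_of_site i b ιB parS (Oc k) U hpar hM₂ hrepr s' hK (hGGc k))
      fun a a'' => le_of_eq (by ring)
  exact hasMajorant_conj_Cinv_final_loc i b ιB d' P Sχ S χ h (fun k => (XY i parS (Oc k) U).restrictScalars ℝ) Cl hs
    (mul_nonneg (sq_nonneg _) hκG) hκD hℓ₀ hℓ₁ hB₀ hC0 hN hP hδ₀ hasep hρ hρb hαc hα'1 hsplit₁ hsplit₂ hsplit₃ hθ₁ hθ₂ hθ₃ htri hrefl hsymm hdnn hST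
    h261b h261 h263 hsmall (restrictScalars_XinvY_mul_XY i parS Gp U hunit) hsq hh hS hcnt hχ01 hχS hχsupp hsep hLip hloc hC hLmaj hLloc hD

end Member

/-! ## §3 ★★ The end-to-end statement: fed with Theorem 3.1's (3.42) blocks of `G′(U)` and of the `G′_□(U)` over the invariant class (FILE 8 re-assembled) -/

section OfEBlock

variable {B : B9.Backgrounds} (cfg : B.Cfg → CfgY 𝔸 i) (O : SiteOpY 𝔸 i) (parS : SiteParY 𝔸 i) {U₁ : B.Cfg}

/-- ★★ **THEOREM 3.9 ⇒ THEOREM 3.2 (3.48) FOR `C(U) = (Q′G′²Q′*)⁻¹(U)` FROM THEOREM 3.1's (3.42) BLOCKS OF `G′(U)` AND OF THE CUBE LETTERS `G′_□(U)`, PRINTED-SHAPE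
INPUTS** (FILE 8's `hasMajorant_conj_XinvY_of_eBlockInv` with the three repaired binders: `hC` un-localized, `hD` the LOCALIZED [2]-difference
`conj b ((η²η²)•(M_{1_{S^χ_□}}(XY G′ − XY G′_□)M_{1_{S_□}}))`, `hχsupp : supp χ_□ ⊂ S^χ_□`): under the `EBlock`s of `G′ = O` and of every `G′_□ = Oc □`, the
section `ιB`, `IsUnit XY`, contractive transporters, FILE 7's geometry at `((1−α_G)δ_G, α₂)`, the target rate `a_Lδ₀ ≦ (1−α₂)(1−α_G)δ_G`, the cut-off data,
the local inverse property, per-cube `hC`, localized `hD`, the geometry at `(δ₀, b−ρ)`, `(ρδ₀, α′)`, the scale transfer of `ℓ⁻⁴` and the located smallness: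
`conj b (s•(XinvY i parS O U)) ≺ N·B₀·c₁(ρδ₀,α′)(1 − (θ₁+θ₂+θ₃)c₁)⁻¹·ℓ(a)⁻⁴·e^{−(1−α′)ρδ₀d(a,a′)}` with FILE 8's `κ_G`, `θ₁`, `θ₂`, `θ₃`.
[cite: Balaban1985BackgroundPropagators, Thm 3.9 p.413 + (3.95)–(3.97) pp.411–412 + (3.87) p.409 + Thm 3.1 (3.42) p.397 + Thm 3.2 (3.48) p.398;
Balaban1984PropagatorsII, Lemma 2.1 p.234 + (2.83)–(2.85) p.237] -/
theorem hasMajorant_conj_XinvY_of_eBlockInv_loc {κι : Type} [Fintype κι] (Oc : κι → SiteOpY 𝔸 i)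
    {BG δG : ℝ} (hE : EBlock (kernelFamilySInv i B cfg O parS) BG δG U₁) (hEc : ∀ k, EBlock (kernelFamilySInv i B cfg (Oc k) parS) BG δG U₁)
    (hBG : 0 ≤ BG) (hι : ∀ s, β i.hN i.D i.hk (ιB s) = s)
    (hunit : IsUnit (XY i parS O (cfg U₁)))
    (hpar : ∀ z w : SiteY i, ‖(parS (cfg U₁) z w : 𝔸)‖ ≤ 1 ∧ ‖(((parS (cfg U₁) z w)⁻¹ : 𝔸ˣ) : 𝔸)‖ ≤ 1)
    {M₂ : ℝ} (hM₂ : 0 ≤ M₂) (hrepr : ∀ (v : 𝔸) (j : ι), |b.repr v j| ≤ M₂ * ‖v‖) (d' d₂ : ℕ)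
    {αG α₂ CG : ℝ} (hCG : 0 ≤ CG) (hαGδ : 0 ≤ αG * δG) (hα₂0 : 0 ≤ α₂) (hα₂1 : α₂ ≤ 1) (hδG : 0 ≤ (1 - αG) * δG)
    (hSTG : B9Ineq347.ScaleTransfer (geo9K i) δG αG CG (fun a => (geo9K i).len a ^ 2))
    (h261G : Ineq261 d₂ (toB6 (geo9K i) Rr Hp) ((1 - αG) * δG) α₂)
    {δ₀ aL aD αc αst asep ρ bb κG κD Dsep ℓ₀ ℓ₁ B₀ C N s α' θ₁ θ₂ θ₃ : ℝ} (hrate : aL * δ₀ ≤ (1 - α₂) * ((1 - αG) * δG))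
    (Sχ S : κι → Finset (geo9K i).Site) (χ h : κι → BlkY i → ℝ) (Cl : κι → Module.End ℝ (BlkY i → 𝔸))
    (hs : (etaS i ^ 2 * etaS i ^ 2) * s = 1) (hκD : 0 ≤ κD) (hℓ₀ : 0 ≤ ℓ₀) (hℓ₁ : 0 ≤ ℓ₁) (hB₀ : 0 ≤ B₀) (hC0 : 0 ≤ C) (hN : 0 ≤ N)
    (hδ₀ : 0 ≤ δ₀) (hasep : 0 ≤ asep) (hρ : 0 ≤ ρ) (hρb : ρ ≤ bb) (hαc : 0 < αc * δ₀) (hα'1 : α' ≤ 1)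
    (hsplit₁ : αst + asep + ρ ≤ aL) (hsplit₂ : αst + ρ ≤ aD) (hsplit₃ : αst + αc + ρ ≤ aL)
    (hκG : κG = (M₂ * (∑ j, ‖b j‖) * BG) ^ 2 * CG * B6.c1 d₂ ((1 - αG) * δG) α₂)
    (hθ₁ : θ₁ = N * (((M₂ * ∑ j, ‖b j‖) ^ 2 * κG) * B₀ * C * B6.c1 d' δ₀ (bb - ρ) * Real.exp (-(asep * δ₀ * Dsep))))
    (hθ₂ : θ₂ = N * (κD * Real.exp (-(2 * δ₀ * Dsep)) * B₀ * C * B6.c1 d' δ₀ (bb - ρ)))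
    (hθ₃ : θ₃ = N * ((ℓ₀ + ℓ₁ * (αc * δ₀)⁻¹) * ((M₂ * ∑ j, ‖b j‖) ^ 2 * κG) * B₀ * C * B6.c1 d' δ₀ (bb - ρ)))
    (htri : Triangle254 (toB6 (geo9K i) Rr Hp)) (hrefl : ∀ y : (geo9K i).Site, (geo9K i).dist y y = 0)
    (hsymm : ∀ a a' : (geo9K i).Site, (geo9K i).dist a a' = (geo9K i).dist a' a) (hdnn : ∀ a a' : (geo9K i).Site, 0 ≤ (geo9K i).dist a a')
    (hST : B9Ineq347.ScaleTransfer (geo9K i) δ₀ αst C (fun a => ((geo9K i).len a ^ 4)⁻¹)) (h261b : Ineq261 d' (toB6 (geo9K i) Rr Hp) δ₀ (bb - ρ))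
    (h261 : Ineq261 d' (toB6 (geo9K i) Rr Hp) (ρ * δ₀) α') (h263 : Ineq263 d' (toB6 (geo9K i) Rr Hp) (ρ * δ₀) α')
    (hsmall : (θ₁ + θ₂ + θ₃) * B6.c1 d' (ρ * δ₀) α' < 1)
    (hsq : ∀ t, ∑ k, h k t ^ 2 = 1) (hh : ∀ k t, |h k t| ≤ 1) (hS : ∀ k t, h k t ≠ 0 → ιB t ∈ S k)
    (hcnt : ∀ a : (geo9K i).Site, (∑ k, if a ∈ S k then (1 : ℝ) else 0) ≤ N)
    (hχ01 : ∀ k t, 0 ≤ χ k t ∧ χ k t ≤ 1) (hχS : ∀ k t, ιB t ∈ Sχ k → χ k t = 1) (hχsupp : ∀ k t, χ k t ≠ 0 → ιB t ∈ Sχ k)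
    (hsep : ∀ k a, a ∉ Sχ k → ∀ a'' ∈ S k, Dsep ≤ (geo9K i).dist a a'')
    (hLip : ∀ k (t t' : BlkY i), |h k t' - h k t| ≤ ℓ₀ + ℓ₁ * (geo9K i).dist (ιB t) (ιB t'))
    (hloc : ∀ k, (cutMulY (𝔸 := 𝔸) (h k)).restrictScalars ℝ *
      ((cutMulY (𝔸 := 𝔸) (χ k)).restrictScalars ℝ * (XY i parS (Oc k) (cfg U₁)).restrictScalars ℝ) * Cl k * (cutMulY (𝔸 := 𝔸) (h k)).restrictScalars ℝ =
      (cutMulY (𝔸 := 𝔸) (h k)).restrictScalars ℝ * (cutMulY (𝔸 := 𝔸) (h k)).restrictScalars ℝ)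
    (hC : ∀ k, HasMajorant (g := toB6 (geo9K i) Rr Hp) (fun p : BlkY i × ι => ιB p.1) (conj b (s • Cl k))
      (fun a a' => B₀ * ((geo9K i).len a ^ 4)⁻¹ * Real.exp (-(bb * δ₀ * (geo9K i).dist a a'))))
    (hD : ∀ k, HasMajorant (g := toB6 (geo9K i) Rr Hp) (fun p : BlkY i × ι => ιB p.1)
      (conj b ((etaS i ^ 2 * etaS i ^ 2) • ((cutMulY (𝔸 := 𝔸) (fun t : BlkY i => if ιB t ∈ Sχ k then (1 : ℝ) else 0)).restrictScalars ℝ *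
        ((XY i parS O (cfg U₁)).restrictScalars ℝ - (XY i parS (Oc k) (cfg U₁)).restrictScalars ℝ) *
        (cutMulY (𝔸 := 𝔸) (fun t : BlkY i => if ιB t ∈ S k then (1 : ℝ) else 0)).restrictScalars ℝ)))
      (fun a a'' => κD * Real.exp (-(2 * δ₀ * Dsep)) * (geo9K i).len a ^ 4 * Real.exp (-(aD * δ₀ * (geo9K i).dist a a'')))) :
    HasMajorant (g := toB6 (geo9K i) Rr Hp) (fun p : BlkY i × ι => ιB p.1) (conj b (s • (XinvY i parS O (cfg U₁)).restrictScalars ℝ))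
      (fun a a' => N * B₀ * B6.c1 d' (ρ * δ₀) α' * (1 - (θ₁ + θ₂ + θ₃) * B6.c1 d' (ρ * δ₀) α')⁻¹ * ((geo9K i).len a ^ 4)⁻¹ *
        Real.exp (-((1 - α') * (ρ * δ₀) * (geo9K i).dist a a'))) := by
  subst hκG
  have hP : ∀ a : (geo9K i).Site, 0 < ((geo9K i).len a ^ 4)⁻¹ := fun a => inv_pos.mpr (pow_pos (B6KLevelCensusIndexV1.len_pos i a) 4)
  -- the localized [2]-difference majorants at the weight `(P a)⁻¹ = ((ℓ⁴)⁻¹)⁻¹`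
  have hD' : ∀ k, HasMajorant (g := toB6 (geo9K i) Rr Hp) (fun p : BlkY i × ι => ιB p.1)
      (conj b ((etaS i ^ 2 * etaS i ^ 2) • ((cutMulY (𝔸 := 𝔸) (fun t : BlkY i => if ιB t ∈ Sχ k then (1 : ℝ) else 0)).restrictScalars ℝ *
        ((XY i parS O (cfg U₁)).restrictScalars ℝ - (XY i parS (Oc k) (cfg U₁)).restrictScalars ℝ) *
        (cutMulY (𝔸 := 𝔸) (fun t : BlkY i => if ιB t ∈ S k then (1 : ℝ) else 0)).restrictScalars ℝ)))
      (fun a a'' => κD * Real.exp (-(2 * δ₀ * Dsep)) * (((geo9K i).len a ^ 4)⁻¹)⁻¹ * Real.exp (-(aD * δ₀ * (geo9K i).dist a a''))) := fun k =>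
    hasMajorant_mono (g := toB6 (geo9K i) Rr Hp) _ (hD k) fun a a'' => le_of_eq (by rw [inv_inv])
  -- §2 fed with FILE 7's site majorants of `η⁴G′²` and `η⁴G′_□²`
  exact hasMajorant_conj_XinvY_final_loc i b ιB parS O (cfg U₁) hunit hpar hM₂ hrepr d' (fun a => ((geo9K i).len a ^ 4)⁻¹) Sχ S χ h Oc Cl hs
    (mul_nonneg (mul_nonneg (sq_nonneg _) hCG) (B6RandomWalk.c1_nonneg d₂ _ _)) hκD hℓ₀ hℓ₁ hB₀ hC0 hN hP hδ₀ hasep hρ hρb hαc hα'1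
    hsplit₁ hsplit₂ hsplit₃ hθ₁ hθ₂ hθ₃ htri hrefl hsymm hdnn hST h261b h261 h263 hsmall hsq hh hS hcnt hχ01 hχS hχsupp hsep hLip hloc hC
    (hasMajorant_conj_GG_of_eBlockInv i b cfg O parS hE hBG ιB hι hM₂ hrepr d₂ hCG hαGδ hα₂0 hα₂1 hδG htri hdnn hSTG h261G hrate)
    (fun k => hasMajorant_conj_GG_of_eBlockInv i b cfg (Oc k) parS (hEc k) hBG ιB hι hM₂ hrepr d₂ hCG hαGδ hα₂0 hα₂1 hδG htri hdnn hSTG h261G hrate)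
    hD'

/-- ★★ **THEOREM 3.2 (3.48) FOR `C(U) = (Q′G′²Q′*)⁻¹(U)` POINTWISE, PRINTED-SHAPE INPUTS** («|(Q′(U)G′²(U)Q′*(U))⁻¹(y, y′)| ≦ B₀(Lʲη)⁻⁴(L^{j′}η)^{−d}e^{−δ₀d(y,y′)}»,
constant and rate explicit): under the hypotheses of `hasMajorant_conj_XinvY_of_eBlockInv_loc` and `0 ≦ s`, every source `λ` supported at one block `s₀` with
`‖λ(s₀)‖ ≦ 1` obeys `s·‖(XinvY i parS O U λ)(t)‖ ≦ (Σ_j‖b_j‖)M₂·[N B₀c₁(ρδ₀,α′)(1 − (θ₁+θ₂+θ₃)c₁(ρδ₀,α′))⁻¹]·ℓ(ιB t)⁻⁴·e^{−(1−α′)ρδ₀·d(ιB t, ιB s₀)}`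
(FILE 1's block reading BY NAME). [cite: Balaban1985BackgroundPropagators, Thm 3.2 (3.48) p.398 via Thm 3.9 p.413 + Thm 3.1 (3.42) p.397; Balaban1984PropagatorsII, (2.51) p.232] -/
theorem norm_XinvY_apply_of_eBlockInv_loc {κι : Type} [Fintype κι] (Oc : κι → SiteOpY 𝔸 i)
    {BG δG : ℝ} (hE : EBlock (kernelFamilySInv i B cfg O parS) BG δG U₁) (hEc : ∀ k, EBlock (kernelFamilySInv i B cfg (Oc k) parS) BG δG U₁)
    (hBG : 0 ≤ BG) (hι : ∀ s, β i.hN i.D i.hk (ιB s) = s)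
    (hunit : IsUnit (XY i parS O (cfg U₁)))
    (hpar : ∀ z w : SiteY i, ‖(parS (cfg U₁) z w : 𝔸)‖ ≤ 1 ∧ ‖(((parS (cfg U₁) z w)⁻¹ : 𝔸ˣ) : 𝔸)‖ ≤ 1)
    {M₂ : ℝ} (hM₂ : 0 ≤ M₂) (hrepr : ∀ (v : 𝔸) (j : ι), |b.repr v j| ≤ M₂ * ‖v‖) (d' d₂ : ℕ)
    {αG α₂ CG : ℝ} (hCG : 0 ≤ CG) (hαGδ : 0 ≤ αG * δG) (hα₂0 : 0 ≤ α₂) (hα₂1 : α₂ ≤ 1) (hδG : 0 ≤ (1 - αG) * δG)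
    (hSTG : B9Ineq347.ScaleTransfer (geo9K i) δG αG CG (fun a => (geo9K i).len a ^ 2))
    (h261G : Ineq261 d₂ (toB6 (geo9K i) Rr Hp) ((1 - αG) * δG) α₂)
    {δ₀ aL aD αc αst asep ρ bb κG κD Dsep ℓ₀ ℓ₁ B₀ C N s α' θ₁ θ₂ θ₃ : ℝ} (hrate : aL * δ₀ ≤ (1 - α₂) * ((1 - αG) * δG))
    (Sχ S : κι → Finset (geo9K i).Site) (χ h : κι → BlkY i → ℝ) (Cl : κι → Module.End ℝ (BlkY i → 𝔸))
    (hs : (etaS i ^ 2 * etaS i ^ 2) * s = 1) (hs0 : 0 ≤ s) (hκD : 0 ≤ κD) (hℓ₀ : 0 ≤ ℓ₀) (hℓ₁ : 0 ≤ ℓ₁) (hB₀ : 0 ≤ B₀) (hC0 : 0 ≤ C) (hN : 0 ≤ N)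
    (hδ₀ : 0 ≤ δ₀) (hasep : 0 ≤ asep) (hρ : 0 ≤ ρ) (hρb : ρ ≤ bb) (hαc : 0 < αc * δ₀) (hα'1 : α' ≤ 1)
    (hsplit₁ : αst + asep + ρ ≤ aL) (hsplit₂ : αst + ρ ≤ aD) (hsplit₃ : αst + αc + ρ ≤ aL)
    (hκG : κG = (M₂ * (∑ j, ‖b j‖) * BG) ^ 2 * CG * B6.c1 d₂ ((1 - αG) * δG) α₂)
    (hθ₁ : θ₁ = N * (((M₂ * ∑ j, ‖b j‖) ^ 2 * κG) * B₀ * C * B6.c1 d' δ₀ (bb - ρ) * Real.exp (-(asep * δ₀ * Dsep))))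
    (hθ₂ : θ₂ = N * (κD * Real.exp (-(2 * δ₀ * Dsep)) * B₀ * C * B6.c1 d' δ₀ (bb - ρ)))
    (hθ₃ : θ₃ = N * ((ℓ₀ + ℓ₁ * (αc * δ₀)⁻¹) * ((M₂ * ∑ j, ‖b j‖) ^ 2 * κG) * B₀ * C * B6.c1 d' δ₀ (bb - ρ)))
    (htri : Triangle254 (toB6 (geo9K i) Rr Hp)) (hrefl : ∀ y : (geo9K i).Site, (geo9K i).dist y y = 0)
    (hsymm : ∀ a a' : (geo9K i).Site, (geo9K i).dist a a' = (geo9K i).dist a' a) (hdnn : ∀ a a' : (geo9K i).Site, 0 ≤ (geo9K i).dist a a')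
    (hST : B9Ineq347.ScaleTransfer (geo9K i) δ₀ αst C (fun a => ((geo9K i).len a ^ 4)⁻¹)) (h261b : Ineq261 d' (toB6 (geo9K i) Rr Hp) δ₀ (bb - ρ))
    (h261 : Ineq261 d' (toB6 (geo9K i) Rr Hp) (ρ * δ₀) α') (h263 : Ineq263 d' (toB6 (geo9K i) Rr Hp) (ρ * δ₀) α')
    (hsmall : (θ₁ + θ₂ + θ₃) * B6.c1 d' (ρ * δ₀) α' < 1)
    (hsq : ∀ t, ∑ k, h k t ^ 2 = 1) (hh : ∀ k t, |h k t| ≤ 1) (hS : ∀ k t, h k t ≠ 0 → ιB t ∈ S k)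
    (hcnt : ∀ a : (geo9K i).Site, (∑ k, if a ∈ S k then (1 : ℝ) else 0) ≤ N)
    (hχ01 : ∀ k t, 0 ≤ χ k t ∧ χ k t ≤ 1) (hχS : ∀ k t, ιB t ∈ Sχ k → χ k t = 1) (hχsupp : ∀ k t, χ k t ≠ 0 → ιB t ∈ Sχ k)
    (hsep : ∀ k a, a ∉ Sχ k → ∀ a'' ∈ S k, Dsep ≤ (geo9K i).dist a a'')
    (hLip : ∀ k (t t' : BlkY i), |h k t' - h k t| ≤ ℓ₀ + ℓ₁ * (geo9K i).dist (ιB t) (ιB t'))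
    (hloc : ∀ k, (cutMulY (𝔸 := 𝔸) (h k)).restrictScalars ℝ *
      ((cutMulY (𝔸 := 𝔸) (χ k)).restrictScalars ℝ * (XY i parS (Oc k) (cfg U₁)).restrictScalars ℝ) * Cl k * (cutMulY (𝔸 := 𝔸) (h k)).restrictScalars ℝ =
      (cutMulY (𝔸 := 𝔸) (h k)).restrictScalars ℝ * (cutMulY (𝔸 := 𝔸) (h k)).restrictScalars ℝ)
    (hC : ∀ k, HasMajorant (g := toB6 (geo9K i) Rr Hp) (fun p : BlkY i × ι => ιB p.1) (conj b (s • Cl k))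
      (fun a a' => B₀ * ((geo9K i).len a ^ 4)⁻¹ * Real.exp (-(bb * δ₀ * (geo9K i).dist a a'))))
    (hD : ∀ k, HasMajorant (g := toB6 (geo9K i) Rr Hp) (fun p : BlkY i × ι => ιB p.1)
      (conj b ((etaS i ^ 2 * etaS i ^ 2) • ((cutMulY (𝔸 := 𝔸) (fun t : BlkY i => if ιB t ∈ Sχ k then (1 : ℝ) else 0)).restrictScalars ℝ *
        ((XY i parS O (cfg U₁)).restrictScalars ℝ - (XY i parS (Oc k) (cfg U₁)).restrictScalars ℝ) *
        (cutMulY (𝔸 := 𝔸) (fun t : BlkY i => if ιB t ∈ S k then (1 : ℝ) else 0)).restrictScalars ℝ)))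
      (fun a a'' => κD * Real.exp (-(2 * δ₀ * Dsep)) * (geo9K i).len a ^ 4 * Real.exp (-(aD * δ₀ * (geo9K i).dist a a''))))
    (lam : BlkY i → 𝔸) (s₀ : BlkY i) (hsupp : ∀ t, t ≠ s₀ → lam t = 0) (hbd : ‖lam s₀‖ ≤ 1) (t : BlkY i) :
    s * ‖XinvY i parS O (cfg U₁) lam t‖ ≤ (∑ j, ‖b j‖) * M₂ * (N * B₀ * B6.c1 d' (ρ * δ₀) α' * (1 - (θ₁ + θ₂ + θ₃) * B6.c1 d' (ρ * δ₀) α')⁻¹) *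
      ((geo9K i).len (ιB t) ^ 4)⁻¹ * Real.exp (-((1 - α') * (ρ * δ₀) * (geo9K i).dist (ιB t) (ιB s₀))) := by
  have hmaj := hasMajorant_conj_XinvY_of_eBlockInv_loc i b ιB cfg O parS (Rr := Rr) (Hp := Hp) Oc hE hEc hBG hι hunit hpar hM₂ hrepr d' d₂ hCG hαGδ
    hα₂0 hα₂1 hδG hSTG h261G hrate Sχ S χ h Cl hs hκD hℓ₀ hℓ₁ hB₀ hC0 hN hδ₀ hasep hρ hρb hαc hα'1 hsplit₁ hsplit₂ hsplit₃ hκG hθ₁ hθ₂ hθ₃ htri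
    hrefl hsymm hdnn hST h261b h261 h263 hsmall hsq hh hS hcnt hχ01 hχS hχsupp hsep hLip hloc hC hD
  have hw := norm_apply_le_of_hasMajorant_blk i b ιB (s • (XinvY i parS O (cfg U₁)).restrictScalars ℝ) hM₂ hrepr hmaj lam s₀ zero_le_one hsupp hbd t
  rw [LinearMap.smul_apply, Pi.smul_apply, LinearMap.restrictScalars_apply, norm_smul, Real.norm_eq_abs, abs_of_nonneg hs0] at hw
  exact hw.trans (le_of_eq (by ring))

end OfEBlock

end Literature.MathematicalPhysics.QuantumFieldTheory.Balaban1983to89.B9Thm39CinvFinalLoc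

end
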